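import Mathlib
import Summits.ResolutionOfSingularities.ResolutionOfSingularities.Theorems.WeightedInvariantLocalWeightedDropNCResSettingHeadDropSurfaceCentre
import Summits.ResolutionOfSingularities.ResolutionOfSingularities.Theorems.WeightedInvariantLocalWeightedDropNCResCurveGraphDefs

/-!
# `WeightedInvariant.LocalWeightedDrop`: NC-resolution settings for the TOT₂ line — GRAPH SURFACES: definitions
# (the sub-regime «apex dimension `e ≤ 2`, the point lies ON a permissible smooth SURFACE» = S-E2-SURF, every dimension)

Crux item stmt-ResolutionOfSingularities-8899 `LocalWeightedDrop` (route `ResolutionOfSingularities/WeightedInvariant`), ENGINE skeleton v32, residuals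
`stub_spaceNCRankDrop` (m = 2) and `stub_wildWideApexFourStartsWon` (W4|₄; res-L1-w43-strat-1's line `directrix-cut` v3.1, piece PL =
`ApexPlaneExit`, SURFACE sub-case — design memo `L/res-L1-w43-stub-4/g5/S-E2-SURF.md`, evidence #59 on stmt-8899).  [OURS · L1 W4.3 · chain w43 ·
seat res-L1-w43-stub-4 gen 5; DEFINITIONS + their immediate algebra; the surface twin of res-L1-w43-stub-1's `GraphCurve` layer (S-SET 14,
`…NCResCurveGraphDefs`); the count game is the programme's own; nothing here is a statement of any manuscript; AI-produced, gate-checked, weaker than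
expert review.]

WHY.  At apex dimension `e(g) = 2` (`g = f·∏_{l∈O} x_l` of order `c`, four letters at `m = 3`) a point ON a `c`-fold SMOOTH SURFACE germ `S` (necessarily
`T_S = Dir`) is near for ever under point blow-ups unless `S` is blown up, and `S` may be blown up (S-SET `IsBPermissible` (P3)) only when it is a
coordinate subspace of LETTER-PRESERVING coordinates — then ONE move drops the head (`dWinsTo_headDrop_of_surfaceCentre`, p542077).  As for curves, the
sub-regime is run on an explicit GRAPH PRESENTATION of `S` over a coordinate PLANE `(x_a, x_b)`:
* `GraphSurf.onPlane a b ψ` — the two-variable series `ψ` placed on the letters `x_a, x_b` (`subst ![X a, X b] ψ`);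
* `GraphSurf.shear a b ψ` — the GRAPH SHEAR `x_a ↦ x_a`, `x_b ↦ x_b`, `x_j ↦ x_j + ψ_j(x_a, x_b)` (a legal coordinate change whose image of the
  coordinate plane `V(x_j : j ∉ {a, b})` is the surface `S = {x_j = ψ_j(x_a, x_b)}` when `ψ_j(0) = 0`); the TRACE of a letter `x_l` (`l ∉ {a,b}`) on `S`
  is `ψ_l` itself;
* `GraphSurf.offDeg₂ a b E`, `GraphSurf.InOffPlaneIdeal a b c G` — the degree of an exponent OFF the base letters, and «every monomial of `G` has
  off-base degree `≥ c`» = `G ∈ (x_j : j ∉ {a,b})^c` = the base plane is permissible for `G` at order `c`;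
* **`GraphSurf.dWinsTo_headDrop_of_terminal`** — THE TERMINAL STEP: if every boundary letter outside the base has trace `0` (its plane CONTAINS `S`),
  the graph shear is letter-preserving and the surface move drops the head in one move (`e(g) ≤ 2`, `m ≥ 2`).
Sequels (memo §3): entry bridge «legal `Φ` with `InOffPlaneIdeal` ⇒ graph presentation», the point-move and curve-move steps, the measure, the loop.
-/

set_option linter.dupNamespace false -- mandated namespace of this single-conjunct summit

noncomputable section

namespace Summit.ResolutionOfSingularities.ResolutionOfSingularities.Theorems

namespace TameFourTupleDrop

namespace GraphSurf

open MvPowerSeries Literature.AlgebraicGeometry.Resolution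

variable {k : Type} [Field k] {m : ℕ}

/-! ## Two-variable series on a pair of letters -/

/-- The base substitution `(u₁, u₂) ↦ (x_a, x_b)`. -/
theorem hasSubst_base (a b : Fin (m + 1)) : HasSubst (![X a, X b] : Fin 2 → MvPowerSeries (Fin (m + 1)) k) :=
  hasSubst_of_constantCoeff_zero fun t => by fin_cases t <;> simp [constantCoeff_X]

/-- The two-variable series `ψ` placed on the letters `x_a, x_b`: `ψ(x_a, x_b) ∈ k⟦x₀,…,x_m⟧`. [OURS] -/
def onPlane (a b : Fin (m + 1)) (ψ : MvPowerSeries (Fin 2) k) : MvPowerSeries (Fin (m + 1)) k :=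
  subst ![X a, X b] ψ

/-- `onPlane` is the underlying function of an algebra map. -/
theorem onPlane_eq_substAlgHom (a b : Fin (m + 1)) (ψ : MvPowerSeries (Fin 2) k) :
    onPlane a b ψ = substAlgHom (hasSubst_base (k := k) a b) ψ := by
  rw [onPlane, coe_substAlgHom]

/-- `0(x_a, x_b) = 0`. -/
theorem onPlane_zero (a b : Fin (m + 1)) : onPlane a b (0 : MvPowerSeries (Fin 2) k) = 0 := by
  rw [onPlane_eq_substAlgHom, map_zero]

/-- `(-ψ)(x_a, x_b) = -ψ(x_a, x_b)`. -/
theorem onPlane_neg (a b : Fin (m + 1)) (ψ : MvPowerSeries (Fin 2) k) : onPlane a b (-ψ) = -onPlane a b ψ := by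
  rw [onPlane_eq_substAlgHom, onPlane_eq_substAlgHom, map_neg]

/-- `(ψ + χ)(x_a, x_b)`. -/
theorem onPlane_add (a b : Fin (m + 1)) (ψ χ : MvPowerSeries (Fin 2) k) : onPlane a b (ψ + χ) = onPlane a b ψ + onPlane a b χ := by
  rw [onPlane_eq_substAlgHom, onPlane_eq_substAlgHom, onPlane_eq_substAlgHom, map_add]

/-- Constant coefficient of `ψ(x_a, x_b)`. -/
theorem constantCoeff_onPlane (a b : Fin (m + 1)) (ψ : MvPowerSeries (Fin 2) k) :
    constantCoeff (onPlane a b ψ) = constantCoeff ψ :=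
  TOT2E1.constantCoeff_subst_of_constantCoeff_zero _ (fun t => by fin_cases t <;> simp [constantCoeff_X]) ψ

/-- Substituting a family `Λ` into `ψ(x_a, x_b)` gives `ψ(Λ_a, Λ_b)`. -/
theorem subst_onPlane {n : ℕ} (Λ : Fin (m + 1) → MvPowerSeries (Fin n) k) (hΛ : HasSubst Λ) (a b : Fin (m + 1))
    (ψ : MvPowerSeries (Fin 2) k) : subst Λ (onPlane a b ψ) = subst ![Λ a, Λ b] ψ := by
  rw [onPlane, subst_comp_subst_apply (hasSubst_base a b) hΛ]
  congr 1
  funext t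
  fin_cases t
  · simp [subst_X hΛ]
  · simp [subst_X hΛ]

/-! ## The graph shear -/

/-- The GRAPH SHEAR of the surface `S = {x_j = ψ_j(x_a, x_b) : j ∉ {a,b}}`: `x_a ↦ x_a`, `x_b ↦ x_b`, `x_j ↦ x_j + ψ_j(x_a, x_b)`.
(The components `ψ_a`, `ψ_b` are never read.) [OURS] -/
def shear (a b : Fin (m + 1)) (ψ : Fin (m + 1) → MvPowerSeries (Fin 2) k) : Fin (m + 1) → MvPowerSeries (Fin (m + 1)) k :=
  fun j => if j = a ∨ j = b then X j else X j + onPlane a b (ψ j)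

/-- The shear fixes the base letters. -/
theorem shear_of_base {a b j : Fin (m + 1)} (h : j = a ∨ j = b) (ψ : Fin (m + 1) → MvPowerSeries (Fin 2) k) : shear a b ψ j = X j :=
  if_pos h

/-- The shear fixes `x_a`. -/
theorem shear_left (a b : Fin (m + 1)) (ψ : Fin (m + 1) → MvPowerSeries (Fin 2) k) : shear a b ψ a = X a :=
  shear_of_base (Or.inl rfl) ψ

/-- The shear fixes `x_b`. -/
theorem shear_right (a b : Fin (m + 1)) (ψ : Fin (m + 1) → MvPowerSeries (Fin 2) k) : shear a b ψ b = X b :=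
  shear_of_base (Or.inr rfl) ψ

/-- The shear on the other letters. -/
theorem shear_of_ne {a b j : Fin (m + 1)} (h : ¬ (j = a ∨ j = b)) (ψ : Fin (m + 1) → MvPowerSeries (Fin 2) k) :
    shear a b ψ j = X j + onPlane a b (ψ j) :=
  if_neg h

/-- The shear has zero constant terms when `ψ_j(0) = 0` for all `j ∉ {a, b}`. -/
theorem constantCoeff_shear {a b : Fin (m + 1)} {ψ : Fin (m + 1) → MvPowerSeries (Fin 2) k}
    (hψ : ∀ j, ¬ (j = a ∨ j = b) → constantCoeff (ψ j) = 0) (j : Fin (m + 1)) : constantCoeff (shear a b ψ j) = 0 := by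
  by_cases h : j = a ∨ j = b
  · rw [shear_of_base h, constantCoeff_X]
  · rw [shear_of_ne h, map_add, constantCoeff_X, constantCoeff_onPlane, hψ j h, add_zero]

/-- The shear may be substituted. -/
theorem hasSubst_shear {a b : Fin (m + 1)} {ψ : Fin (m + 1) → MvPowerSeries (Fin 2) k}
    (hψ : ∀ j, ¬ (j = a ∨ j = b) → constantCoeff (ψ j) = 0) : HasSubst (shear a b ψ) :=
  hasSubst_of_constantCoeff_zero (constantCoeff_shear hψ)

/-- The shear fixes every series in the base letters. -/
theorem subst_shear_onPlane {a b : Fin (m + 1)} {ψ : Fin (m + 1) → MvPowerSeries (Fin 2) k}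
    (hψ : ∀ j, ¬ (j = a ∨ j = b) → constantCoeff (ψ j) = 0) (χ : MvPowerSeries (Fin 2) k) :
    subst (shear a b ψ) (onPlane a b χ) = onPlane a b χ := by
  rw [subst_onPlane _ (hasSubst_shear hψ), shear_left, shear_right, onPlane]

/-- THE INVERSE SHEAR: shearing by `ψ` after shearing by `−ψ` is the identity. -/
theorem subst_shear_shear_neg {a b : Fin (m + 1)} {ψ : Fin (m + 1) → MvPowerSeries (Fin 2) k}
    (hψ : ∀ j, ¬ (j = a ∨ j = b) → constantCoeff (ψ j) = 0) (j : Fin (m + 1)) :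
    subst (shear a b ψ) (shear a b (-ψ) j) = X j := by
  have hs := hasSubst_shear hψ
  by_cases h : j = a ∨ j = b
  · rw [shear_of_base h, subst_X hs, shear_of_base h]
  · rw [shear_of_ne h, ← coe_substAlgHom hs, map_add, coe_substAlgHom, subst_X hs, shear_of_ne h, subst_shear_onPlane hψ,
      Pi.neg_apply, onPlane_neg]
    ring

/-- THE GRAPH SHEAR IS A LEGAL COORDINATE CHANGE: invertible linear part. -/
theorem isUnit_det_linMat_shear {a b : Fin (m + 1)} {ψ : Fin (m + 1) → MvPowerSeries (Fin 2) k}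
    (hψ : ∀ j, ¬ (j = a ∨ j = b) → constantCoeff (ψ j) = 0) :
    IsUnit (Matrix.det (Matrix.of fun i j : Fin (m + 1) => coeff (Finsupp.single j 1) (shear a b ψ i))) := by
  have hψ' : ∀ j, ¬ (j = a ∨ j = b) → constantCoeff ((-ψ) j) = 0 := fun j hj => by
    rw [Pi.neg_apply, map_neg, hψ j hj, neg_zero]
  exact TOT2E1.isUnit_det_linMat_of_comp_eq_X (constantCoeff_shear hψ) (subst_shear_shear_neg (ψ := ψ) hψ)

/-- The graph shear with weights `w ∈ {0,1}^{m+1} ∖ 0` is a move of the count game. -/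
theorem isCountMove_shear {a b : Fin (m + 1)} {ψ : Fin (m + 1) → MvPowerSeries (Fin 2) k}
    (hψ : ∀ j, ¬ (j = a ∨ j = b) → constantCoeff (ψ j) = 0) {w : Fin (m + 1) → ℕ} (hw : ∀ j, w j ≤ 1) (hpos : ∃ j, 0 < w j) :
    IsCountMove (shear a b ψ) w :=
  ⟨constantCoeff_shear hψ, isUnit_det_linMat_shear hψ, hw, hpos⟩

/-- The graph shear is letter-preserving on the base letters and on every letter with trace `ψ_l = 0` (a letter plane CONTAINING the surface). -/
theorem shear_eq_X_of_eq_zero {a b : Fin (m + 1)} {ψ : Fin (m + 1) → MvPowerSeries (Fin 2) k} {l : Fin (m + 1)}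
    (h : (l = a ∨ l = b) ∨ ψ l = 0) : shear a b ψ l = X l := by
  by_cases hl : l = a ∨ l = b
  · rw [shear_of_base hl]
  · rw [shear_of_ne hl, h.resolve_left hl, onPlane_zero, add_zero]

/-! ## Off-base degree and the permissibility ideal -/

/-- The degree of an exponent OFF the base letters `a, b`. [OURS] -/
def offDeg₂ (a b : Fin (m + 1)) (E : Fin (m + 1) →₀ ℕ) : ℕ := ∑ j ∈ (Finset.univ.erase a).erase b, E j

/-- Off-base degree is additive. -/
theorem offDeg₂_add (a b : Fin (m + 1)) (E F : Fin (m + 1) →₀ ℕ) : offDeg₂ a b (E + F) = offDeg₂ a b E + offDeg₂ a b F := by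
  simp only [offDeg₂, Finsupp.coe_add, Pi.add_apply, Finset.sum_add_distrib]

/-- Off-base degree of zero. -/
theorem offDeg₂_zero (a b : Fin (m + 1)) : offDeg₂ a b (0 : Fin (m + 1) →₀ ℕ) = 0 := by
  simp [offDeg₂]

/-- Membership in the off-base index set. -/
theorem mem_offBase_iff {a b j : Fin (m + 1)} : j ∈ (Finset.univ.erase a).erase b ↔ ¬ (j = a ∨ j = b) := by
  simp only [Finset.mem_erase, Finset.mem_univ, and_true, not_or]
  tauto

/-- Off-base degree of a power of a base letter is `0`. -/
theorem offDeg₂_single_base {a b j : Fin (m + 1)} (h : j = a ∨ j = b) (n : ℕ) : offDeg₂ a b (Finsupp.single j n) = 0 := by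
  rw [offDeg₂]
  refine Finset.sum_eq_zero fun l hl => ?_
  rw [Finsupp.single_apply, if_neg]
  rintro rfl
  exact (mem_offBase_iff.mp hl) h

/-- Off-base degree of a power of an off-base letter is its exponent. -/
theorem offDeg₂_single_of_ne {a b j : Fin (m + 1)} (h : ¬ (j = a ∨ j = b)) (n : ℕ) : offDeg₂ a b (Finsupp.single j n) = n := by
  rw [offDeg₂, Finset.sum_eq_single_of_mem j (mem_offBase_iff.mpr h) (fun l _ hl => by rw [Finsupp.single_apply, if_neg (Ne.symm hl)]),
    Finsupp.single_eq_same]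

/-- The weight of an exponent for the weights `𝟙_{j ∉ {a,b}}` is its off-base degree. -/
theorem weight_indicator_eq_offDeg₂ (a b : Fin (m + 1)) (E : Fin (m + 1) →₀ ℕ) :
    Finsupp.weight (fun j : Fin (m + 1) => if j = a ∨ j = b then 0 else 1) E = offDeg₂ a b E := by
  classical
  rw [Finsupp.weight_apply, Finsupp.sum_fintype _ _ (fun _ => by simp), offDeg₂]
  rw [← Finset.sum_subset (Finset.subset_univ ((Finset.univ.erase a).erase b))
    (fun j _ hj => by
      have h : j = a ∨ j = b := by
        by_contra h
        exact hj (mem_offBase_iff.mpr h)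
      simp [h])]
  exact Finset.sum_congr rfl fun j hj => by simp [mem_offBase_iff.mp hj]

/-- `InOffPlaneIdeal a b c G`: every monomial of `G` has off-base degree `≥ c` — `G ∈ (x_j : j ∉ {a,b})^c`, i.e. THE BASE COORDINATE PLANE
`V(x_j : j ∉ {a,b})` IS PERMISSIBLE FOR `G` AT ORDER `c`. [OURS] -/
def InOffPlaneIdeal (a b : Fin (m + 1)) (c : ℕ) (G : MvPowerSeries (Fin (m + 1)) k) : Prop :=
  ∀ E : Fin (m + 1) →₀ ℕ, coeff E G ≠ 0 → c ≤ offDeg₂ a b E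

/-- `InOffPlaneIdeal` gives the `𝟙_{j ∉ {a,b}}`-weighted order bound `c` (the permissibility inequality of `dWinsTo_headDrop_of_surfaceCentre`). -/
theorem le_weightedOrder_of_inOffPlaneIdeal {a b : Fin (m + 1)} {c : ℕ} {G : MvPowerSeries (Fin (m + 1)) k} (h : InOffPlaneIdeal a b c G) :
    (c : ℕ∞) ≤ G.weightedOrder (fun j : Fin (m + 1) => if j = a ∨ j = b then 0 else 1) := by
  refine le_weightedOrder _ fun E hE => ?_
  by_contra hne
  rw [weight_indicator_eq_offDeg₂, Nat.cast_lt] at hE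
  exact absurd (h E hne) (not_le.mpr hE)

/-- `InOffPlaneIdeal` is monotone in the order. -/
theorem InOffPlaneIdeal.mono {a b : Fin (m + 1)} {c c' : ℕ} (hcc : c' ≤ c) {G : MvPowerSeries (Fin (m + 1)) k} (h : InOffPlaneIdeal a b c G) :
    InOffPlaneIdeal a b c' G :=
  fun E hE => hcc.trans (h E hE)

/-- `InOffPlaneIdeal` is symmetric in the base letters. -/
theorem InOffPlaneIdeal.symm {a b : Fin (m + 1)} {c : ℕ} {G : MvPowerSeries (Fin (m + 1)) k} (h : InOffPlaneIdeal a b c G) :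
    InOffPlaneIdeal b a c G := by
  intro E hE
  have hset : (Finset.univ.erase b).erase a = (Finset.univ.erase a).erase b := by
    ext j
    simp only [Finset.mem_erase, Finset.mem_univ, and_true]
    tauto
  have heq : offDeg₂ b a E = offDeg₂ a b E := by rw [offDeg₂, offDeg₂, hset]
  rw [heq]
  exact h E hE

/-! ## The terminal step: every letter outside the base contains the surface -/

/-- **THE TERMINAL STEP OF S-E2-SURF** (OURS · L1 W4.3; every `m ≥ 2`, every field).  From an admissibly decorated position `(b₀, δ)` with `e(g) ≤ 2`
(`g = f·∏_O x_l`, every three invariance vectors of `in_c g` dependent), a graph presentation of a permissible surface over the base letters `(x_a, x_b)`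
(`ψ_j(0) = 0`, `InOffPlaneIdeal a b c (shear^* g)`) ALL of whose traces on boundary letters vanish (`ψ_l = 0` for `l ∈ E ∖ {a,b}`: every boundary plane
outside the base CONTAINS the surface) forces «admissibly decorated of strictly smaller head» in ONE move: the shear is letter-preserving, so the surface move
`(shear a b ψ, 𝟙_{j ∉ {a,b}})` is B-permissible and has no near point (`dWinsTo_headDrop_of_surfaceCentre`). -/
theorem dWinsTo_headDrop_of_terminal {b₀ : MvPowerSeries (Fin (m + 1)) k} {δ : Decoration k m} (hadm : Admissible b₀ δ) (hm : 2 ≤ m)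
    {a b : Fin (m + 1)} (hab : a ≠ b) {ψ : Fin (m + 1) → MvPowerSeries (Fin 2) k}
    (hψ : ∀ j, ¬ (j = a ∨ j = b) → constantCoeff (ψ j) = 0)
    (hterm : ∀ l ∈ δ.E, ¬ (l = a ∨ l = b) → ψ l = 0)
    (hperm : InOffPlaneIdeal a b δ.c (subst (shear a b ψ) (δ.f * ∏ l ∈ δ.O, X l)))
    (htwo : ∀ u₁ u₂ u₃ : Fin (m + 1) → k,
      (∀ v, CobordantChart.initEval (fun _ : Fin (m + 1) => 1) (v + u₁) δ.c (δ.f * ∏ l ∈ δ.O, X l) =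
        CobordantChart.initEval (fun _ : Fin (m + 1) => 1) v δ.c (δ.f * ∏ l ∈ δ.O, X l)) →
      (∀ v, CobordantChart.initEval (fun _ : Fin (m + 1) => 1) (v + u₂) δ.c (δ.f * ∏ l ∈ δ.O, X l) =
        CobordantChart.initEval (fun _ : Fin (m + 1) => 1) v δ.c (δ.f * ∏ l ∈ δ.O, X l)) →
      (∀ v, CobordantChart.initEval (fun _ : Fin (m + 1) => 1) (v + u₃) δ.c (δ.f * ∏ l ∈ δ.O, X l) =
        CobordantChart.initEval (fun _ : Fin (m + 1) => 1) v δ.c (δ.f * ∏ l ∈ δ.O, X l)) →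
      ∃ α β γ : k, (α ≠ 0 ∨ β ≠ 0 ∨ γ ≠ 0) ∧ α • u₁ + β • u₂ + γ • u₃ = 0) :
    DWinsTo (St := MvPowerSeries (Fin (m + 1)) k × Decoration k m) Prod.fst
      (fun τ => Admissible τ.1 τ.2 ∧ τ.2.head < δ.head) (b₀, δ) := by
  refine dWinsTo_headDrop_of_surfaceCentre hadm hm (constantCoeff_shear hψ) (isUnit_det_linMat_shear hψ) (fun l hl => ?_) hab
    (le_weightedOrder_of_inOffPlaneIdeal hperm) htwo
  refine ⟨l, 1, by rw [map_one]; exact one_ne_zero, ?_⟩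
  rw [one_mul]
  by_cases h : l = a ∨ l = b
  · exact shear_of_base h ψ
  · exact shear_eq_X_of_eq_zero (Or.inr (hterm l hl h))

end GraphSurf

end TameFourTupleDrop

end Summit.ResolutionOfSingularities.ResolutionOfSingularities.Theorems

end
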